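import Summits.QuantumFields.YangMills.Theorems.BalabanUVNodesK2JsOfRecord

/-! # CRIT-2 g3 — SINGLE-POLYMER COLLAPSE of idea-5 g10 Sketch3's box interface (cheapest falsifier of «the representation carries content»)

`BoxActivityRepr` / `LinOnBox` below are VERBATIM copies of `Cruxes/EndpointGivenBR13SepCoPH/Idea5g10CornerModulusRoadSketch3.lean`
(commit 3309c1c8983d) :433–:447 (re-declared here only because crux workfiles are not imported).  CLAIM (kernel): whenever the plain
LINEAR box remainder `BoxRemainder β b Cr γ₀` (tree, `…K2JsOfRecord.lean` :210) holds, the interface pair is inhabited by a ONE-TERM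
«expansion» (the whole remainder sitting on the empty polymer) — so, AS TYPED, `(∃ R : BoxActivityRepr β b γ₀, LinOnBox R)` is implied by
the letter it is meant to PRODUCE, and the ★★★★ chain of Sketch3 §5 is the tree's `endpointExistence_of_drift_boxRemainder` road
(idea-4 ∕ PORT-1, p59xxxx) at the corner `b`, wearing a polymer index.  (Conversely `LinOnBox R` gives only the Tannery modulus, not a linear
remainder — the interface is sandwiched: linear box remainder ⟹ interface ⟹ box modulus; by a dyadic decomposition in `p (Fin.last k)` the
second arrow reverses for bounded moduli, so the interface is EQUIVALENT to the bounded box-modulus letter.)  Nothing of Bałaban asserted. -/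

open Literature.MathematicalPhysics.QuantumFieldTheory.Balaban1983to89
open Literature.MathematicalPhysics.QuantumFieldTheory.Balaban1983to89.FlowStep
open Literature.MathematicalPhysics.QuantumFieldTheory.Balaban1983to89.B12Beta (HistBox)
open Summit.QuantumFields.YangMills.Theorems.BalabanUVNodesK2JsOfRecord (BoxRemainder)

namespace Crit2Collapse

abbrev LocDomainZ4 : Type := Finset (Fin 4 → ℤ)

/-- VERBATIM Sketch3 :433–:443. -/
structure BoxActivityRepr (β : HBeta) (b : ℕ → ℝ) (γ₀ : ℝ) where
  I : LocDomainZ4 → (k : ℕ) → (Fin (k + 1) → ℝ) → ℝ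
  M : LocDomainZ4 → ℝ
  M_nonneg : ∀ X, 0 ≤ M X
  M_summable : Summable M
  hasSum_box : ∀ (k : ℕ) (p : Fin (k + 1) → ℝ), p ∈ HistBox γ₀ k → HasSum (fun X => I X k p) (β k p - b k)
  frozen_box : ∀ (k : ℕ) (p : Fin (k + 1) → ℝ), p ∈ HistBox γ₀ k → ∀ X, |I X k p| ≤ M X

/-- VERBATIM Sketch3 :445–:447. -/
def LinOnBox {β : HBeta} {b : ℕ → ℝ} {γ₀ : ℝ} (R : BoxActivityRepr β b γ₀) : Prop :=
  ∃ A : LocDomainZ4 → ℝ, (∀ X, 0 ≤ A X) ∧ ∀ (k : ℕ) (p : Fin (k + 1) → ℝ), p ∈ HistBox γ₀ k → ∀ X, |R.I X k p| ≤ A X * p (Fin.last k)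

/-- **SINGLE-POLYMER COLLAPSE**: the linear box remainder inhabits the interface pair with ONE non-zero term. [folklore] -/
theorem linOnBox_of_boxRemainder {β : HBeta} {b : ℕ → ℝ} {Cr γ₀ : ℝ} (hrem : BoxRemainder β b Cr γ₀) (hCr : 0 ≤ Cr) (hγ₀ : 0 ≤ γ₀) :
    ∃ R : BoxActivityRepr β b γ₀, LinOnBox R := by
  classical
  refine ⟨{ I := fun X k p => if X = ∅ then β k p - b k else 0
            M := fun X => if X = ∅ then Cr * γ₀ else 0
            M_nonneg := fun X => by by_cases hX : X = ∅ <;> simp [hX, mul_nonneg hCr hγ₀]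
            M_summable := (hasSum_ite_eq (∅ : LocDomainZ4) (Cr * γ₀)).summable
            hasSum_box := fun k p _ => hasSum_ite_eq (∅ : LocDomainZ4) (β k p - b k)
            frozen_box := fun k p hp X => by
              by_cases hX : X = ∅
              · simp only [hX, if_true]
                exact (hrem k p hp).trans (mul_le_mul_of_nonneg_left (hp _).2 hCr)
              · simp [hX] }, ?_⟩
  refine ⟨fun X => if X = ∅ then Cr else 0, fun X => by by_cases hX : X = ∅ <;> simp [hX, hCr], fun k p hp X => ?_⟩
  by_cases hX : X = ∅
  · simp only [hX, if_true]
    exact hrem k p hp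
  · simp [hX]

/-- … and conversely the interface pair gives back AT MOST the linear-or-frozen bound termwise — in particular, when the constants happen to be summable, the linear box
remainder itself (the general case gives only the Tannery modulus, Sketch3 `boxModulus_of_linOnBox`). [folklore] -/
theorem boxRemainder_of_linOnBox_summable {β : HBeta} {b : ℕ → ℝ} {γ₀ : ℝ} (R : BoxActivityRepr β b γ₀)
    {A : LocDomainZ4 → ℝ} (hAs : Summable A)
    (hlin : ∀ (k : ℕ) (p : Fin (k + 1) → ℝ), p ∈ HistBox γ₀ k → ∀ X, |R.I X k p| ≤ A X * p (Fin.last k)) :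
    BoxRemainder β b (∑' X, A X) γ₀ := by
  intro k p hp
  rw [← (R.hasSum_box k p hp).tsum_eq]
  have hsumI : Summable fun X => R.I X k p :=
    Summable.of_norm_bounded R.M_summable (fun X => by simpa [Real.norm_eq_abs] using R.frozen_box k p hp X)
  have hsumAp : Summable fun X => A X * p (Fin.last k) := hAs.mul_right _
  have h1 : ‖∑' X, R.I X k p‖ ≤ ∑' X, ‖R.I X k p‖ := norm_tsum_le_tsum_norm hsumI.norm
  simp only [Real.norm_eq_abs] at h1
  calc |∑' X, R.I X k p| ≤ ∑' X, |R.I X k p| := h1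
    _ ≤ ∑' X, A X * p (Fin.last k) := by
          exact (hsumI.abs).tsum_le_tsum (fun X => hlin k p hp X) hsumAp
    _ = (∑' X, A X) * p (Fin.last k) := tsum_mul_right

end Crit2Collapse
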